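import Mathlib.RepresentationTheory.Coinduced
import Mathlib.RepresentationTheory.Homological.GroupCohomology.Shapiro
import Mathlib.RepresentationTheory.Homological.GroupCohomology.Functoriality
import Mathlib.GroupTheory.Index
import HarnessLib

/-!
# Route `SignedLowerHalves`, crux L `SmallImageLowerHalfBothSigns` (item stmt-BirchSwinnertonDyer-23599), line `rtt_w3` v5 —
# brick B2 of the road of record for the engine stub PSB_T3 (card `shapiro`, step E1b): SHAPIRO ∘ MACKEY
# `Hⁿ(N, Res^G_N Coind_U^G ψ) ≅ Hⁿ(N ∩ U, Res ψ)` whenever `G = U·N`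

LEAD `cruxlead-stmt-BirchSwinnertonDyer-23599` g3 (cell `bsd-ssimc`); ROUTE-INDEPENDENT helper (`--supports stmt-BirchSwinnertonDyer-23599`); pure
algebra over Mathlib's `Representation.coind` / `Rep.coind` / `groupCohomology.coindIso` (Shapiro's lemma); no named fact, no `sorry`; closes
nothing; BSD is not proved by any of this.

WHY (card `Ideas/shapiro.md`, LEAD census `Lines/rtt_w3-CENSUS-PSB-g3.md` §2, E1): on the small-image class the residual representation is
induced, `ρ̄_{W,p} ⊗ k ≅ Ind_{G_K}^{G_ℚ} ψ̄` with `K ∩ ℚ_n = ℚ` for every layer `ℚ_n` of the cyclotomic tower; the comparison `W ↔ φ` of signed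
residual Selmer groups runs through `H¹(Gal(L/ℚ_n), Ind ψ̄) ≅ H¹(Gal(L/Kℚ_n), ψ̄)`. In group-theoretic terms: `G ⊇ U, N` subgroups with
`U·N = G` (`U = Gal(L/K)`, `N = Gal(L/ℚ_n)`; for `U` of index `2` this is `N ⊄ U`, `mul_eq_of_index_two`), `ψ` a `U`-representation;
then restriction of functions is an `N`-equivariant isomorphism `Res_N Coind_U^G ψ ≅ Coind^N_{U ∩ N} Res ψ` (§1, the Mackey formula with a
single double coset — the card's FIRST LEMMA, re-cut so that the small subgroup is `U.subgroupOf N : Subgroup N`, the shape Mathlib's Shapiro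
isomorphism consumes), whence (§2) `Hⁿ(N, Res_N Coind_U^G ψ) ≅ Hⁿ(U ∩ N, Res ψ)` in `ModuleCat k` by `groupCohomology.functor … |>.mapIso` of `Rep.mkIso`
followed by `groupCohomology.coindIso`.

THEOREMS ONLY (no `def`: the isomorphisms are delivered as `∃` / `Nonempty` statements with their characterising property, so that the file is
kernel-reviewed; a later `…Defs` file may name them). The homomorphism `U ∩ N → U` is spelled inline as
`(N.subtype.comp (U.subgroupOf N).subtype).codRestrict U (fun s ↦ Subgroup.mem_subgroupOf.mp s.2)`.
* §1 `exists_mackeyEquiv` — `∃ e : Res_N Coind_U^G ψ ≃ Coind^N_{U∩N} Res ψ` (`Representation.Equiv`) acting by restriction of functions;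
  `mul_eq_of_index_two` (the hypothesis `G = U·N` from `[G:U] = 2`, `N ⊄ U`).
* §2 ★ `nonempty_shapiroMackeyIso : Nonempty (Hⁿ(N, Res_N Coind_U^G B) ≅ Hⁿ(U.subgroupOf N, Res B))`, its index-`2` form, and the `finrank` equality.

References: [Rubin1991] §4 (the `χ`-components, Shapiro over `K`); [Kobayashi2003] Def. 1.1; [PollackRubin2004] §3 display (2) — only as
motivation; the content is textbook (Brown, Cohomology of Groups, III.5–6; Neukirch–Schmidt–Wingberg (1.6.4)). [folklore]
-/

set_option autoImplicit false
-- D-0017: single-problem summit, the namespace repeats the problem name by design.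
set_option linter.dupNamespace false
noncomputable section

open CategoryTheory Representation

universe u

namespace Summit.BirchSwinnertonDyer.BirchSwinnertonDyer.Theorems.SmallImageRttShapiro

/-! ## §1 The Mackey restriction isomorphism for one double coset (`G = U·N`) -/

section Mackey

variable {k G : Type u} [CommRing k] [Group G] (U N : Subgroup G)
  {A : Type u} [AddCommGroup A] [Module k A] (ψ : Representation k U A)

/-- **Mackey restriction isomorphism (one double coset).** If `G = U·N` then restriction of functions `f ↦ f|_N` is an `N`-equivariant
`k`-linear isomorphism `Res^G_N Coind_U^G ψ ≃ Coind^N_{U∩N} Res ψ` — a `Representation.Equiv` between the `N`-representation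
`(coind U.subtype ψ).comp N.subtype` and `coind (U.subgroupOf N).subtype (ψ.comp ι)`, `ι : U.subgroupOf N →* U` the tautological map —
characterised by `(e f)(n) = f(n)`. Injectivity: a `U`-equivariant function is determined on `N`; surjectivity (the Mackey content): a
`(U ∩ N)`-equivariant `h` on `N` extends to `F(u·n) := ψ(u) h(n)`, well defined because two factorisations differ by an element of `U ∩ N`.
[folklore] -/
theorem exists_mackeyEquiv (hUN : ∀ g : G, ∃ u : U, ∃ n : N, g = (u : G) * (n : G)) :
    ∃ e : Representation.Equiv ((coind U.subtype ψ).comp N.subtype)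
        (coind (U.subgroupOf N).subtype
          (ψ.comp ((N.subtype.comp (U.subgroupOf N).subtype).codRestrict U fun s ↦ Subgroup.mem_subgroupOf.mp s.2))),
      ∀ (f : coindV U.subtype ψ) (n : N), (e.toLinearEquiv f).1 n = f.1 (n : G) := by
  classical
  -- the tautological map `U ∩ N → U`
  let ι : U.subgroupOf N →* U :=
    (N.subtype.comp (U.subgroupOf N).subtype).codRestrict U fun s ↦ Subgroup.mem_subgroupOf.mp s.2
  have hι : ∀ s : U.subgroupOf N, ((ι s : U) : G) = ((s : N) : G) := fun _ ↦ rfl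
  -- restriction of functions
  let rF : coindV U.subtype ψ →ₗ[k] coindV (U.subgroupOf N).subtype (ψ.comp ι) :=
    { toFun := fun f ↦ ⟨fun n ↦ f.1 (n : G), fun s n ↦ by
        have h := f.2 (ι s) (n : G)
        simpa [hι] using h⟩
      map_add' := fun _ _ ↦ rfl
      map_smul' := fun _ _ ↦ rfl }
  have rF_apply : ∀ (f : coindV U.subtype ψ) (n : N), (rF f).1 n = f.1 (n : G) := fun _ _ ↦ rfl
  have inj : Function.Injective rF := by
    intro f g hfg
    apply Subtype.ext
    funext x
    obtain ⟨u, n, rfl⟩ := hUN x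
    have hn : f.1 (n : G) = g.1 (n : G) := by
      have := congrArg (fun h ↦ (h : coindV (U.subgroupOf N).subtype (ψ.comp ι)).1 n) hfg
      simpa [rF_apply] using this
    have hf := f.2 u (n : G)
    have hg := g.2 u (n : G)
    simp only [Subgroup.coe_subtype] at hf hg
    rw [hf, hg, hn]
  have surj : Function.Surjective rF := by
    intro h
    choose u n hun using hUN
    let F : G → A := fun x ↦ ψ (u x) (h.1 (n x))
    have key : ∀ (x : G) (u' : U) (n' : N), x = (u' : G) * (n' : G) → F x = ψ u' (h.1 n') := by
      intro x u' n' hx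
      have hx' : (u x : G) * (n x : G) = (u' : G) * (n' : G) := (hun x).symm.trans hx
      have hsG : ((u' : G))⁻¹ * (u x : G) = (n' : G) * ((n x : G))⁻¹ := by
        calc ((u' : G))⁻¹ * (u x : G)
            = ((u' : G))⁻¹ * ((u x : G) * (n x : G)) * ((n x : G))⁻¹ := by group
          _ = ((u' : G))⁻¹ * ((u' : G) * (n' : G)) * ((n x : G))⁻¹ := by rw [hx']
          _ = (n' : G) * ((n x : G))⁻¹ := by group
      have hsU : ((u' : G))⁻¹ * (u x : G) ∈ U := U.mul_mem (U.inv_mem u'.2) (u x).2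
      have hsN : ((u' : G))⁻¹ * (u x : G) ∈ N := by
        rw [hsG]; exact N.mul_mem n'.2 (N.inv_mem (n x).2)
      let s : U.subgroupOf N := ⟨⟨((u' : G))⁻¹ * (u x : G), hsN⟩, Subgroup.mem_subgroupOf.mpr hsU⟩
      have h1 : (U.subgroupOf N).subtype s * n x = n' := by
        apply Subtype.ext
        change ((u' : G))⁻¹ * (u x : G) * (n x : G) = (n' : G)
        rw [hsG]; group
      have h2 : u' * ι s = u x := by
        apply Subtype.ext
        change (u' : G) * (((u' : G))⁻¹ * (u x : G)) = (u x : G)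
        group
      have h3 := h.2 s (n x)
      rw [h1] at h3
      calc F x = ψ (u x) (h.1 (n x)) := rfl
        _ = ψ (u' * ι s) (h.1 (n x)) := by rw [h2]
        _ = ψ u' (ψ (ι s) (h.1 (n x))) := by rw [map_mul]; rfl
        _ = ψ u' (h.1 n') := by rw [h3]; rfl
    refine ⟨⟨F, fun u' x ↦ ?_⟩, ?_⟩
    · have hx : U.subtype u' * x = ((u' * u x : U) : G) * (n x : G) := by
        rw [Subgroup.coe_subtype, Subgroup.coe_mul, mul_assoc, ← hun x]
      rw [key _ (u' * u x) (n x) hx, map_mul]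
      rfl
    · apply Subtype.ext
      funext m
      change F (m : G) = h.1 m
      rw [key (m : G) 1 m (by simp), map_one]
      rfl
  refine ⟨Representation.Equiv.mk (LinearEquiv.ofBijective rF ⟨inj, surj⟩) fun n₀ ↦ ?_, fun f n ↦ rfl⟩
  apply LinearMap.ext
  intro f
  exact Subtype.ext (funext fun _ ↦ rfl)

/-- The index-`2` source of the hypothesis `G = U·N`: if `[G : U] = 2` and `N ⊄ U` then every `g ∈ G` is `u·n` (`u = g·n₀⁻¹ ∈ U` for any
`n₀ ∈ N ∖ U` when `g ∉ U`). On the crux: `U = Gal(L/K)` has index `2` and `N = Gal(L/ℚ_n) ⊄ U` because `K ⊄ ℚ_n`. [folklore] -/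
theorem mul_eq_of_index_two (hU : U.index = 2) (hN : ¬ N ≤ U) (g : G) : ∃ u : U, ∃ n : N, g = (u : G) * (n : G) := by
  obtain ⟨n₀, hn₀N, hn₀U⟩ := Set.not_subset.mp hN
  by_cases hg : g ∈ U
  · exact ⟨⟨g, hg⟩, 1, by simp⟩
  · have hmem : g * n₀⁻¹ ∈ U := by
      rw [Subgroup.mul_mem_iff_of_index_two hU]
      exact ⟨fun h ↦ absurd h hg, fun h ↦ absurd (by simpa using h) hn₀U⟩
    exact ⟨⟨g * n₀⁻¹, hmem⟩, ⟨n₀, hn₀N⟩, by simp⟩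

end Mackey

/-! ## §2 ★ Shapiro ∘ Mackey on cohomology -/

section Shapiro

variable {k G : Type u} [CommRing k] [Group G] (U N : Subgroup G)

/-- ★ **Shapiro ∘ Mackey.** If `G = U·N` then for every `U`-representation `B` and every degree `n` there is an isomorphism
`Hⁿ(N, Res^G_N Coind_U^G B) ≅ Hⁿ(U ∩ N, Res B)` in `ModuleCat k` (`U ∩ N` as `U.subgroupOf N`): the cohomology functor
(`groupCohomology.functor`) applied to the Mackey isomorphism of §1 (`Rep.mkIso`), followed by Mathlib's Shapiro isomorphism
`groupCohomology.coindIso`. With `G = Gal(L/ℚ)` (or `Γ_ℚ`), `U = Gal(L/K)`, `N = Gal(L/ℚ_n)`: `Hⁿ(ℚ_n, Ind_K^ℚ ψ) ≅ Hⁿ(Kℚ_n, ψ)` — step E1b of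
the card `shapiro` for the engine stub PSB_T3. [folklore] -/
theorem nonempty_shapiroMackeyIso (B : Rep.{u} k U) (hUN : ∀ g : G, ∃ u : U, ∃ n : N, g = (u : G) * (n : G)) (n : ℕ) :
    Nonempty (groupCohomology (Rep.res N.subtype (Rep.coind U.subtype B)) n ≅
      groupCohomology (Rep.res ((N.subtype.comp (U.subgroupOf N).subtype).codRestrict U
        fun s ↦ Subgroup.mem_subgroupOf.mp s.2) B) n) := by
  obtain ⟨e, -⟩ := exists_mackeyEquiv U N B.ρ hUN
  exact ⟨(groupCohomology.functor k N n).mapIso (Rep.mkIso e) ≪≫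
    groupCohomology.coindIso (Rep.res ((N.subtype.comp (U.subgroupOf N).subtype).codRestrict U
      fun s ↦ Subgroup.mem_subgroupOf.mp s.2) B) n⟩

/-- ★ The index-`2` form used on the crux: `[G : U] = 2`, `N ⊄ U` ⇒ `Hⁿ(N, Res Coind_U^G B) ≅ Hⁿ(U ∩ N, Res B)`. [folklore] -/
theorem nonempty_shapiroMackeyIso_of_index_two (B : Rep.{u} k U) (hU : U.index = 2) (hN : ¬ N ≤ U) (n : ℕ) :
    Nonempty (groupCohomology (Rep.res N.subtype (Rep.coind U.subtype B)) n ≅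
      groupCohomology (Rep.res ((N.subtype.comp (U.subgroupOf N).subtype).codRestrict U
        fun s ↦ Subgroup.mem_subgroupOf.mp s.2) B) n) :=
  nonempty_shapiroMackeyIso U N B (mul_eq_of_index_two U N hU hN) n

/-- Corollary for the transfer of dimensions (E1 counts `dim_k` of residual Selmer groups): if `G = U·N` the two cohomology modules have
the same `finrank` over `k`. [folklore] -/
theorem finrank_groupCohomology_res_coind_eq (B : Rep.{u} k U) (hUN : ∀ g : G, ∃ u : U, ∃ n : N, g = (u : G) * (n : G)) (n : ℕ) :
    Module.finrank k (groupCohomology (Rep.res N.subtype (Rep.coind U.subtype B)) n) =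
      Module.finrank k (groupCohomology (Rep.res ((N.subtype.comp (U.subgroupOf N).subtype).codRestrict U
        fun s ↦ Subgroup.mem_subgroupOf.mp s.2) B) n) :=
  (nonempty_shapiroMackeyIso U N B hUN n).some.toLinearEquiv.finrank_eq

end Shapiro

end Summit.BirchSwinnertonDyer.BirchSwinnertonDyer.Theorems.SmallImageRttShapiro

end
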